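import Literature.AlgebraicGeometry.HodgeTheory.ComplexOrientationFamily
import Literature.AlgebraicGeometry.HodgeTheory.HodgeClassOfMorphismDuality
import Literature.AlgebraicGeometry.HodgeTheory.TopDegreeClasses
import Literature.AlgebraicGeometry.HodgeTheory.BettiUniverseAxioms
import Literature.AlgebraicTopology.SingularHomology.CohomologyOfPoint
import Literature.AlgebraicTopology.SingularHomology.IntegralLattice
import HarnessLib

/-!
# The canonical trace `∫_X : H²ⁿ(X(ℂ); ℚ) → ℚ` of a smooth projective complex variety

Layer `Literature/AlgebraicGeometry/HodgeTheory`; theorems and two auxiliary definitions, no named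
facts. For `X` smooth projective of dimension `n` over `ℂ`, `X(ℂ)` is a closed connected topological
`2n`-manifold, oriented by the tree's complex orientations (`complexOrientationRat hX` over `ℚ`,
`complexOrientationFamily hX` over `ℂ`, file `HodgeTheory/ComplexOrientationFamily`), and the TRACE
("`∫_X`", "degree map", evaluation on the fundamental class; Voisin I §11.1.2, Fulton *Young Tableaux*
App. B (5), Hatcher §3.3 p. 241) is the Kronecker pairing with the fundamental class `[X(ℂ)]`:

* `trace hX : H²ⁿ(X(ℂ); ℚ) →ₗ[ℚ] ℚ`, `traceC hX : H²ⁿ(X(ℂ); ℂ) →ₗ[ℂ] ℂ`,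
  `a ↦ ε₀⁻¹ · ⟨a, [X(ℂ)]⟩`, where `ε₀ = pointSign = ⟨1, [Spec ℂ (ℂ)]⟩ ∈ {c : ℚ | c ≠ 0}` is the
  universal sign of the tree's complex orientation in dimension `0` (the tree fixes the complex
  orientations only up to a sign `ε(n)` per dimension — `euclideanGenerator`, a choice; the factor
  `ε₀⁻¹` is what makes the class of a point have trace EXACTLY `1`).

PROVED here:
* `pointSign_ne_zero`; `traceC_ringChange` / `traceC_ofRatClass` — `∫_X (a ⊗ 1) = ∫_X a`
  (`[X(ℂ)]_ℂ = ι_*[X(ℂ)]_ℚ`, `fundamentalClass_complexOrientationFamily`);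
* `eq_zero_of_trace_eq_zero`, `exists_trace_eq_one`, `trace_surjective`, `eq_trace_smul`,
  `traceEquiv : H²ⁿ(X(ℂ); ℚ) ≃ₗ[ℚ] ℚ` — `H²ⁿ` is the line detected by `∫_X` (Hatcher Thm. 3.26), and
  the same over `ℂ` (`traceCEquiv`);
* `comp_eq_smul_trace_of_comp_eq_smul` — an identity `τ ∘ g = d • τ` for ONE non-zero functional `τ`
  on the line `H²ⁿ(X(ℂ); ℚ)` (e.g. a coordinate functional such as the tree's light trace
  `BettiUniverse.tr`) transfers to `∫_X ∘ g = d • ∫_X` (the shape of "an isogeny of degree `d` acts by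
  `d` on top cohomology"); `functional_eq_smul_trace`, `exists_bettiUniverse_tr_eq_smul_trace` — every
  functional on the top line, in particular the light trace of `HodgeTheory/BettiUniverseAxioms`, is a
  (non-zero) multiple of `∫_X`;
* `traceDeg hX k` — the graded form (`∫_X` on `H²ⁿ`, `0` on `Hᵏ` for `k ≠ 2n`, `traceDeg_of_ne`).

The normalisation itself — `∫_X f_* = ∫_Y` for the Gysin morphisms of the complex orientation family,
`∫_P 1 = 1` in dimension `0`, **`∫_X [pt] = 1`** and `∫_X cl(Z) = deg Z` for `0`-cycles — is the file
`HodgeTheory/CanonicalTraceCycleClass` (it needs the cycle-class layer).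

Honest scope: `trace` is canonical relative to the tree's cycle classes and Gysin maps (every
identity is free of the convention signs `ε(n)`); it is Voisin's `∫_X` up to the tree-wide convention
sign `ε(n) ε(0)` of `ComplexOrientationFamily`, so POSITIVITY statements (`∫_X ωⁿ > 0` for a Kähler
class) are not claimed here.

## References

* [VoisinHodgeI2002] C. Voisin, Hodge Theory and Complex Algebraic Geometry I, CUP 2002, §11.1.2,
  §7.3.2, §5.3.2 Thm. 5.30.
* [FultonYoungTableaux1997] W. Fulton, Young Tableaux, CUP 1997, App. B §B.1 (5).
* [HatcherAT2002] A. Hatcher, Algebraic Topology, CUP 2002, §3.1 p. 198–199, §3.3 Thm. 3.26, p. 235,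
  p. 241.
-/

noncomputable section

open CategoryTheory AlgebraicGeometry MonoidalCategory
open Literature.AlgebraicTopology.SingularHomology

namespace Literature.AlgebraicGeometry.HodgeTheory

section HodgeTheory

/-! ### §0 Topological preliminaries -/

/-- **`⟨β ⊗ 1, z ⊗ 1⟩ = ⟨β, z⟩`** for the change of coefficients `ℚ → ℂ` on cohomology
(`singularCohomology.ringChange`) and homology (`singularHomology.coeffChange`) classes: on
representatives both sides are `∑ rᵢ β(σᵢ)` read in `ℂ` (the rational analogue of the tree's integral
`kroneckerPairing_ringChange_coeffChange`). [cite: HatcherAT2002, §3.1 p. 198] -/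
theorem kroneckerPairing_ringChange_coeffChange_rat {M : Type} [TopologicalSpace M] {k : ℕ}
    (β : singularCohomology ℚ ℚ M k) (z : singularHomology ℚ ℚ M k) :
    kroneckerPairing ℂ ℂ M k (singularCohomology.ringChange (algebraMap ℚ ℂ) M k β)
        (singularHomology.coeffChange M (algebraMap ℚ ℂ : ℚ →+* ℂ).toAddMonoidHom k z) =
      algebraMap ℚ ℂ (kroneckerPairing ℚ ℚ M k β z) := by
  open singularChainComplex singularCochainComplex in
  induction β using singularCohomology_induction_on with
  | h a =>
    induction z using singularHomology_induction_on with
    | h zc =>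
      rw [singularHomology.coeffChange_homologyπ, singularCohomology.ringChange_π,
        kroneckerPairing_π_homologyπ_eq_evalChain, iCycles_cyclesCoeffChange,
        kroneckerPairing_π_homologyπ_eq_evalChain]
      change evalChain (coFn (cocyclesRingChange (algebraMap ℚ ℂ) k a))
          (baseChangeChain ℚ ℂ k (iCycles ℚ ℚ M k zc)) = _
      rw [coFn_cocyclesRingChange]
      exact evalChain_baseChange ℚ ℂ (coFn a) (iCycles ℚ ℚ M k zc)

variable {n : ℕ} {X : Motives.SchemeOver ℂ}

/-- `H⁰(X(ℂ); R) = R · 1` for `X` smooth projective: every degree-`0` class is a multiple of the unit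
(evaluation at a point of the path-connected `X(ℂ)` — connected by `connectedSpace_complexPoints`,
SGA1 XII Prop. 2.4, and locally path connected as a topological manifold; `singularCohomologyZeroEquiv`).
[cite: HatcherAT2002, §3.1 p. 199] -/
theorem exists_eq_smul_one_of_isSmoothProjective (hX : Motives.IsSmoothProjective n X)
    (R : Type) [CommRing R] (z : singularCohomology R R (Motives.ComplexPoints X) 0) :
    ∃ c : R, z = c • singularCohomology.one R (Motives.ComplexPoints X) := by
  -- `X(ℂ)` is path connected: connected (`connectedSpace_complexPoints`) and locally path connected
  letI := hX.chartedSpace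
  haveI := connectedSpace_complexPoints hX
  haveI : LocallyPathConnectedSpace (Motives.ComplexPoints X) :=
    ChartedSpace.locallyPathConnectedSpace (EuclideanSpace ℝ (Fin (2 * n))) (Motives.ComplexPoints X)
  haveI := pathConnectedSpace_iff_connectedSpace.mpr ‹ConnectedSpace (Motives.ComplexPoints X)›
  refine ⟨singularCohomologyZeroEquiv R R _ z, ?_⟩
  apply (singularCohomologyZeroEquiv R R (Motives.ComplexPoints X)).injective
  rw [map_smul, singularCohomology.one, singularCohomologyZeroEquiv_π,
    singularCochainComplex.cocyclesZeroEquiv_apply, singularCochainComplex.iCocycles_mk,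
    cochainOne_apply, smul_eq_mul, mul_one]

/-! ### §1 The point sign `ε₀` -/

/-- **The point sign `ε₀ = ⟨1, [Spec ℂ (ℂ)]⟩ ∈ ℚ`**: the Kronecker pairing of the unit class with the
fundamental class of the tree's rational complex orientation of the one-point space `(Spec ℂ)(ℂ)`.
Mathematically it is `±1`, the (chosen: `euclideanGenerator 0`) sign convention of the complex
orientations in dimension `0`; that is not proved here — only `ε₀ ≠ 0` (`pointSign_ne_zero`) is proved
and used. [cite: HatcherAT2002, §3.3 p. 235–236] -/
def pointSign : ℚ :=
  kroneckerPairing ℚ ℚ (Motives.ComplexPoints (𝟙_ (Motives.SchemeOver ℂ))) (2 * 0)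
    (singularCohomology.one ℚ (Motives.ComplexPoints (𝟙_ (Motives.SchemeOver ℂ))))
    (complexOrientationRat (Motives.isSmoothProjective_unit_holds ℂ)).fundamentalClass

/-- For `P` of dimension `0`, `⟨1, [P(ℂ)]_ν⟩ ≠ 0` for every `ℚ`-orientation `ν` (a class `w ∈ H⁰` with
`⟨w, [P(ℂ)]⟩ = 1` exists, and `w = c • 1`). [cite: HatcherAT2002, §3.3 Thm. 3.26] -/
theorem kroneckerPairing_one_fundamentalClass_ne_zero_of_dim_zero {P : Motives.SchemeOver ℂ}
    (hP : Motives.IsSmoothProjective 0 P)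
    (ν : HomologicalOrientation ℚ (Motives.ComplexPoints P) (2 * 0)) :
    kroneckerPairing ℚ ℚ (Motives.ComplexPoints P) (2 * 0)
      (singularCohomology.one ℚ (Motives.ComplexPoints P)) ν.fundamentalClass ≠ 0 := by
  obtain ⟨w, hw⟩ := exists_kroneckerPairing_eq_one hP ν
  obtain ⟨c, rfl⟩ := exists_eq_smul_one_of_isSmoothProjective hP ℚ w
  intro h0
  rw [map_smul, LinearMap.smul_apply, h0, smul_zero] at hw
  exact zero_ne_one hw

/-- **`ε₀ ≠ 0`.** [cite: HatcherAT2002, §3.3 Thm. 3.26] -/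
theorem pointSign_ne_zero : pointSign ≠ 0 :=
  kroneckerPairing_one_fundamentalClass_ne_zero_of_dim_zero (Motives.isSmoothProjective_unit_holds ℂ) _

/-! ### §2 The traces -/

/-- **The canonical rational trace** `∫_X : H²ⁿ(X(ℂ); ℚ) →ₗ[ℚ] ℚ` of a smooth projective `X` of
dimension `n`: `a ↦ ε₀⁻¹ · ⟨a, [X(ℂ)]⟩`, the Kronecker pairing with the fundamental class of the
rational complex orientation `complexOrientationRat hX`, normalised by the point sign so that the
class of a point has trace `1` (`traceC_complexGysin_one_of_dim_zero`).
[cite: VoisinHodgeI2002, §11.1.2] [cite: HatcherAT2002, §3.3 p. 241] -/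
def trace (hX : Motives.IsSmoothProjective n X) :
    singularCohomology ℚ ℚ (Motives.ComplexPoints X) (2 * n) →ₗ[ℚ] ℚ :=
  pointSign⁻¹ •
    (kroneckerPairing ℚ ℚ (Motives.ComplexPoints X) (2 * n)).flip
      (complexOrientationRat hX).fundamentalClass

/-- **The canonical complex trace** `∫_X : H²ⁿ(X(ℂ); ℂ) →ₗ[ℂ] ℂ`: `a ↦ ε₀⁻¹ · ⟨a, [X(ℂ)]⟩` for the
complex orientation family `complexOrientationFamily hX` (whose fundamental class is `ι_*` of the
rational one). [cite: VoisinHodgeI2002, §11.1.2] [cite: HatcherAT2002, §3.3 p. 241] -/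
def traceC (hX : Motives.IsSmoothProjective n X) : complexBetti X (2 * n) →ₗ[ℂ] ℂ :=
  ((pointSign : ℂ))⁻¹ •
    (kroneckerPairing ℂ ℂ (Motives.ComplexPoints X) (2 * n)).flip
      (complexOrientationFamily hX).fundamentalClass

/-- Unfolding `trace`: `∫_X a = ε₀⁻¹ · ⟨a, [X(ℂ)]_ℚ⟩`, `⟨a, c⟩ = ε(a ⌢ c)` the Kronecker pairing.
[cite: HatcherAT2002, §3.3 p. 241] -/
theorem trace_apply (hX : Motives.IsSmoothProjective n X)
    (a : singularCohomology ℚ ℚ (Motives.ComplexPoints X) (2 * n)) :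
    trace hX a = pointSign⁻¹ *
      kroneckerPairing ℚ ℚ (Motives.ComplexPoints X) (2 * n) a
        (complexOrientationRat hX).fundamentalClass :=
  rfl

/-- Unfolding `traceC`: `∫_X a = ε₀⁻¹ · ⟨a, [X(ℂ)]⟩`, `⟨a, c⟩ = ε(a ⌢ c)` the Kronecker pairing.
[cite: HatcherAT2002, §3.3 p. 241] -/
theorem traceC_apply (hX : Motives.IsSmoothProjective n X) (a : complexBetti X (2 * n)) :
    traceC hX a = ((pointSign : ℂ))⁻¹ *
      kroneckerPairing ℂ ℂ (Motives.ComplexPoints X) (2 * n) a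
        (complexOrientationFamily hX).fundamentalClass :=
  rfl

/-- **`∫_X (a ⊗ 1) = ∫_X a`**: the complex trace extends the rational one along the change of
coefficients `ℚ → ℂ` (`[X(ℂ)]_ℂ = ι_*[X(ℂ)]_ℚ`, `fundamentalClass_complexOrientationFamily`).
[cite: VoisinHodgeI2002, §7.3.2] [cite: HatcherAT2002, §3.1 p. 198] -/
theorem traceC_ringChange (hX : Motives.IsSmoothProjective n X)
    (a : singularCohomology ℚ ℚ (Motives.ComplexPoints X) (2 * n)) :
    traceC hX (singularCohomology.ringChange (algebraMap ℚ ℂ) (Motives.ComplexPoints X) (2 * n) a) =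
      algebraMap ℚ ℂ (trace hX a) := by
  rw [traceC_apply, trace_apply, fundamentalClass_complexOrientationFamily,
    kroneckerPairing_ringChange_coeffChange_rat, map_mul, map_inv₀, eq_ratCast, eq_ratCast]

/-- `∫_X (ofRatClass a) = ∫_X a` (the `ofRatClass` spelling of `traceC_ringChange`).
[cite: HatcherAT2002, §3.1 p. 198] -/
theorem traceC_ofRatClass (hX : Motives.IsSmoothProjective n X)
    (a : singularCohomology ℚ ℚ (Motives.ComplexPoints X) (2 * n)) :
    traceC hX (ofRatClass (Motives.ComplexPoints X) (2 * n) a) = algebraMap ℚ ℂ (trace hX a) := by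
  rw [ofRatClass_eq_ringChange, traceC_ringChange]

/-! ### §3 `H²ⁿ(X(ℂ))` is the line detected by the trace -/

/-- **A top-degree class with trace `0` vanishes** (`H₂ₙ(X(ℂ); ℚ) = ℚ · [X(ℂ)]` for the closed
connected `X(ℂ)`, and the Kronecker map is injective over a field).
[cite: HatcherAT2002, §3.3 Thm. 3.26 and §3.1 Thm. 3.2] -/
theorem eq_zero_of_trace_eq_zero (hX : Motives.IsSmoothProjective n X)
    {w : singularCohomology ℚ ℚ (Motives.ComplexPoints X) (2 * n)} (hw : trace hX w = 0) :
    w = 0 := by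
  rw [trace_apply, mul_eq_zero, inv_eq_zero] at hw
  exact top_eq_zero_of_kroneckerPairing_eq_zero hX _ (hw.resolve_left pointSign_ne_zero)

/-- `∫_X w = 0 ↔ w = 0` on `H²ⁿ(X(ℂ); ℚ)`. [cite: HatcherAT2002, §3.3 Thm. 3.26] -/
theorem trace_eq_zero_iff (hX : Motives.IsSmoothProjective n X)
    (w : singularCohomology ℚ ℚ (Motives.ComplexPoints X) (2 * n)) : trace hX w = 0 ↔ w = 0 :=
  ⟨eq_zero_of_trace_eq_zero hX, fun h ↦ by rw [h, map_zero]⟩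

/-- The rational trace is injective on `H²ⁿ(X(ℂ); ℚ)`. [cite: HatcherAT2002, §3.3 Thm. 3.26] -/
theorem trace_injective (hX : Motives.IsSmoothProjective n X) : Function.Injective (trace hX) :=
  (injective_iff_map_eq_zero _).2 fun _ ↦ eq_zero_of_trace_eq_zero hX

/-- **A top class of trace `1` exists.** [cite: HatcherAT2002, §3.3 Thm. 3.26] -/
theorem exists_trace_eq_one (hX : Motives.IsSmoothProjective n X) :
    ∃ ω : singularCohomology ℚ ℚ (Motives.ComplexPoints X) (2 * n), trace hX ω = 1 := by
  obtain ⟨w, hw⟩ := exists_kroneckerPairing_eq_one hX (complexOrientationRat hX)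
  refine ⟨pointSign • w, ?_⟩
  rw [map_smul, trace_apply, hw, mul_one, smul_eq_mul, mul_inv_cancel₀ pointSign_ne_zero]

/-- The rational trace is surjective. [cite: HatcherAT2002, §3.3 Thm. 3.26] -/
theorem trace_surjective (hX : Motives.IsSmoothProjective n X) : Function.Surjective (trace hX) := by
  obtain ⟨ω, hω⟩ := exists_trace_eq_one hX
  exact fun c ↦ ⟨c • ω, by rw [map_smul, hω, smul_eq_mul, mul_one]⟩

/-- The rational trace is a non-zero functional. [cite: HatcherAT2002, §3.3 Thm. 3.26] -/
theorem trace_ne_zero (hX : Motives.IsSmoothProjective n X) : trace hX ≠ 0 := by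
  obtain ⟨ω, hω⟩ := exists_trace_eq_one hX
  intro h
  rw [h, LinearMap.zero_apply] at hω
  exact zero_ne_one hω

/-- **`w = (∫_X w) • ω` for any `ω` of trace `1`**: `H²ⁿ(X(ℂ); ℚ)` is the line spanned by `ω`.
[cite: HatcherAT2002, §3.3 Thm. 3.26] -/
theorem eq_trace_smul (hX : Motives.IsSmoothProjective n X)
    {ω : singularCohomology ℚ ℚ (Motives.ComplexPoints X) (2 * n)} (hω : trace hX ω = 1)
    (w : singularCohomology ℚ ℚ (Motives.ComplexPoints X) (2 * n)) : w = trace hX w • ω := by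
  rw [← sub_eq_zero]
  apply eq_zero_of_trace_eq_zero hX
  rw [map_sub, map_smul, hω, smul_eq_mul, mul_one, sub_self]

/-- **The trace is a linear equivalence `H²ⁿ(X(ℂ); ℚ) ≃ ℚ`** (`dim_ℚ H²ⁿ(X(ℂ); ℚ) = 1`, Voisin I
Thm. 5.30 / Hatcher Thm. 3.26, with the canonical normalisation).
[cite: VoisinHodgeI2002, §5.3.2 Thm. 5.30] [cite: HatcherAT2002, §3.3 Thm. 3.26] -/
def traceEquiv (hX : Motives.IsSmoothProjective n X) :
    singularCohomology ℚ ℚ (Motives.ComplexPoints X) (2 * n) ≃ₗ[ℚ] ℚ :=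
  LinearEquiv.ofBijective (trace hX) ⟨trace_injective hX, trace_surjective hX⟩

/-- `traceEquiv` is `trace` as a map. [cite: HatcherAT2002, §3.3 Thm. 3.26] -/
@[simp]
theorem traceEquiv_apply (hX : Motives.IsSmoothProjective n X)
    (w : singularCohomology ℚ ℚ (Motives.ComplexPoints X) (2 * n)) : traceEquiv hX w = trace hX w :=
  rfl

/-- `dim_ℚ H²ⁿ(X(ℂ); ℚ) = 1`, read off the trace (a private copy of the tree's `finrank_rat_top` of
`HodgeTheory/HodgeRiemannPolarizabilityProofs`, whose import cone — hard Lefschetz, the Hodge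
decomposition — is not wanted here). [cite: VoisinHodgeI2002, §5.3.2 Thm. 5.30] -/
private theorem finrank_top_eq_one_of_trace (hX : Motives.IsSmoothProjective n X) :
    Module.finrank ℚ (singularCohomology ℚ ℚ (Motives.ComplexPoints X) (2 * n)) = 1 := by
  rw [(traceEquiv hX).finrank_eq, Module.finrank_self]

/-- **A complex top-degree class with trace `0` vanishes.** [cite: HatcherAT2002, §3.3 Thm. 3.26] -/
theorem eq_zero_of_traceC_eq_zero (hX : Motives.IsSmoothProjective n X) {w : complexBetti X (2 * n)}
    (hw : traceC hX w = 0) : w = 0 := by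
  rw [traceC_apply, mul_eq_zero, inv_eq_zero, Rat.cast_eq_zero] at hw
  exact top_eq_zero_of_kroneckerPairing_eq_zero hX _ (hw.resolve_left pointSign_ne_zero)

/-- `∫_X w = 0 ↔ w = 0` on `H²ⁿ(X(ℂ); ℂ)`. [cite: HatcherAT2002, §3.3 Thm. 3.26] -/
theorem traceC_eq_zero_iff (hX : Motives.IsSmoothProjective n X) (w : complexBetti X (2 * n)) :
    traceC hX w = 0 ↔ w = 0 :=
  ⟨eq_zero_of_traceC_eq_zero hX, fun h ↦ by rw [h, map_zero]⟩

/-- The complex trace is injective on `H²ⁿ(X(ℂ); ℂ)`. [cite: HatcherAT2002, §3.3 Thm. 3.26] -/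
theorem traceC_injective (hX : Motives.IsSmoothProjective n X) : Function.Injective (traceC hX) :=
  (injective_iff_map_eq_zero _).2 fun _ ↦ eq_zero_of_traceC_eq_zero hX

/-- A complex top class of trace `1` exists (the complexification of a rational one).
[cite: HatcherAT2002, §3.3 Thm. 3.26] -/
theorem exists_traceC_eq_one (hX : Motives.IsSmoothProjective n X) :
    ∃ ω : complexBetti X (2 * n), traceC hX ω = 1 := by
  obtain ⟨ω, hω⟩ := exists_trace_eq_one hX
  exact ⟨singularCohomology.ringChange (algebraMap ℚ ℂ) _ (2 * n) ω, by
    rw [traceC_ringChange, hω, map_one]⟩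

/-- The complex trace is surjective. [cite: HatcherAT2002, §3.3 Thm. 3.26] -/
theorem traceC_surjective (hX : Motives.IsSmoothProjective n X) : Function.Surjective (traceC hX) := by
  obtain ⟨ω, hω⟩ := exists_traceC_eq_one hX
  exact fun c ↦ ⟨c • ω, by rw [map_smul, hω, smul_eq_mul, mul_one]⟩

/-- **`w = (∫_X w) • ω` over `ℂ`** for any `ω` of trace `1`. [cite: HatcherAT2002, §3.3 Thm. 3.26] -/
theorem eq_traceC_smul (hX : Motives.IsSmoothProjective n X) {ω : complexBetti X (2 * n)}
    (hω : traceC hX ω = 1) (w : complexBetti X (2 * n)) : w = traceC hX w • ω := by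
  rw [← sub_eq_zero]
  apply eq_zero_of_traceC_eq_zero hX
  rw [map_sub, map_smul, hω, smul_eq_mul, mul_one, sub_self]

/-- **The complex trace is a linear equivalence `H²ⁿ(X(ℂ); ℂ) ≃ ℂ`.**
[cite: VoisinHodgeI2002, §5.3.2 Thm. 5.30] [cite: HatcherAT2002, §3.3 Thm. 3.26] -/
def traceCEquiv (hX : Motives.IsSmoothProjective n X) : complexBetti X (2 * n) ≃ₗ[ℂ] ℂ :=
  LinearEquiv.ofBijective (traceC hX) ⟨traceC_injective hX, traceC_surjective hX⟩

/-- `traceCEquiv` is `traceC` as a map. [cite: HatcherAT2002, §3.3 Thm. 3.26] -/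
@[simp]
theorem traceCEquiv_apply (hX : Motives.IsSmoothProjective n X) (w : complexBetti X (2 * n)) :
    traceCEquiv hX w = traceC hX w :=
  rfl

/-- **An endomorphism of the line `H²ⁿ(X(ℂ); ℚ)` is the scalar `∫_X g ω`** for any `ω` of trace `1`
(`H²ⁿ(X(ℂ); ℚ)` is one-dimensional, Hatcher Thm. 3.26 with universal coefficients).
[cite: HatcherAT2002, §3.3 Thm. 3.26] -/
theorem top_endomorphism_eq_smul_id (hX : Motives.IsSmoothProjective n X)
    {ω : singularCohomology ℚ ℚ (Motives.ComplexPoints X) (2 * n)} (hω : trace hX ω = 1)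
    (g : singularCohomology ℚ ℚ (Motives.ComplexPoints X) (2 * n) →ₗ[ℚ]
      singularCohomology ℚ ℚ (Motives.ComplexPoints X) (2 * n)) :
    g = trace hX (g ω) • LinearMap.id := by
  refine LinearMap.ext fun w ↦ ?_
  rw [LinearMap.smul_apply, LinearMap.id_apply]
  conv_lhs => rw [eq_trace_smul hX hω w, map_smul, eq_trace_smul hX hω (g ω), smul_smul]
  rw [mul_comm (trace hX w) (trace hX (g ω)), ← smul_smul, ← eq_trace_smul hX hω w]

/-- **Transfer of degree identities to the canonical trace.** If ONE non-zero functional `τ` on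
`H²ⁿ(X(ℂ); ℚ)` satisfies `τ ∘ g = d • τ` (e.g. a coordinate functional such as the tree's light trace
`BettiUniverse.tr`, for `g = M^*` the pull-back by an isogeny of degree `d`), then so does the canonical
trace: `∫_X ∘ g = d • ∫_X` (`H²ⁿ` is a line — Hatcher Thm. 3.26 — so `g` is the scalar `d`).
[cite: HatcherAT2002, §3.3 Thm. 3.26] -/
theorem comp_eq_smul_trace_of_comp_eq_smul (hX : Motives.IsSmoothProjective n X)
    {τ : singularCohomology ℚ ℚ (Motives.ComplexPoints X) (2 * n) →ₗ[ℚ] ℚ} (hτ : τ ≠ 0)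
    {g : singularCohomology ℚ ℚ (Motives.ComplexPoints X) (2 * n) →ₗ[ℚ]
      singularCohomology ℚ ℚ (Motives.ComplexPoints X) (2 * n)} {d : ℚ} (h : τ ∘ₗ g = d • τ) :
    trace hX ∘ₗ g = d • trace hX := by
  obtain ⟨ω, hω⟩ := exists_trace_eq_one hX
  -- `τ ω ≠ 0` (else `τ = 0` on the line spanned by `ω`)
  have hτω : τ ω ≠ 0 := by
    intro h0
    apply hτ
    refine LinearMap.ext fun w ↦ ?_
    rw [eq_trace_smul hX hω w, map_smul, h0, smul_zero, LinearMap.zero_apply]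
  -- `g = c • id` with `c = ∫_X g ω`, and `τ (g ω) = d τ ω` forces `c = d`
  have hg := top_endomorphism_eq_smul_id hX hω g
  have hc : trace hX (g ω) = d := by
    have h1 := LinearMap.congr_fun h ω
    rw [LinearMap.comp_apply, LinearMap.smul_apply, hg, LinearMap.smul_apply, LinearMap.id_apply,
      map_smul, smul_eq_mul, smul_eq_mul] at h1
    exact mul_right_cancel₀ hτω h1
  rw [hg, hc, LinearMap.comp_smul, LinearMap.comp_id]

/-! ### §4 Every functional on the top line is a multiple of the trace; the light trace -/

/-- **Every linear functional on `H²ⁿ(X(ℂ); ℚ)` is `τ(ω) • ∫_X`** for any `ω` of trace `1`.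
[cite: HatcherAT2002, §3.3 Thm. 3.26] -/
theorem functional_eq_smul_trace (hX : Motives.IsSmoothProjective n X)
    (τ : singularCohomology ℚ ℚ (Motives.ComplexPoints X) (2 * n) →ₗ[ℚ] ℚ)
    {ω : singularCohomology ℚ ℚ (Motives.ComplexPoints X) (2 * n)} (hω : trace hX ω = 1) :
    τ = τ ω • trace hX := by
  refine LinearMap.ext fun w ↦ ?_
  conv_lhs => rw [eq_trace_smul hX hω w]
  rw [map_smul, LinearMap.smul_apply, smul_eq_mul, smul_eq_mul, mul_comm]

/-- **The tree's light trace is a non-zero multiple of the canonical trace**: `BettiUniverse.tr hX (2n)`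
(the coordinate functional along a chosen basis vector of the line `H²ⁿ(X(ℂ); ℚ)`, file
`HodgeTheory/BettiUniverseAxioms`) equals `c • ∫_X` with `c ≠ 0`.
[cite: VoisinHodgeI2002, §5.3.2 Thm. 5.30] -/
theorem exists_bettiUniverse_tr_eq_smul_trace (hX : Motives.IsSmoothProjective n X) :
    ∃ c : ℚ, c ≠ 0 ∧ BettiUniverse.tr hX (2 * n) = c • trace hX := by
  obtain ⟨ω, hω⟩ := exists_trace_eq_one hX
  refine ⟨BettiUniverse.tr hX (2 * n) ω, fun h0 ↦ ?_, functional_eq_smul_trace hX _ hω⟩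
  have h := functional_eq_smul_trace hX (BettiUniverse.tr hX (2 * n)) hω
  rw [h0, zero_smul] at h
  exact BettiUniverse.tr_ne_zero hX (finrank_top_eq_one_of_trace hX) h

/-! ### §5 The graded form -/

/-- **The graded canonical trace** `∫_X : Hᵏ(X(ℂ); ℚ) →ₗ[ℚ] ℚ`: the canonical trace `trace hX` in the
top degree `k = 2 dim X` and `0` in every other degree (the shape of a universe's `tr X k`).
[cite: VoisinHodgeI2002, §11.1.2] -/
def traceDeg (hX : Motives.IsSmoothProjective n X) (k : ℕ) :
    singularCohomology ℚ ℚ (Motives.ComplexPoints X) k →ₗ[ℚ] ℚ :=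
  if h : k = 2 * n then h ▸ trace hX else 0

/-- In the top degree the graded trace is the canonical trace `∫_X`. [cite: VoisinHodgeI2002, §11.1.2] -/
@[simp]
theorem traceDeg_two_mul (hX : Motives.IsSmoothProjective n X) : traceDeg hX (2 * n) = trace hX :=
  dif_pos rfl

/-- **The trace lives in the top degree only**: `traceDeg hX k = 0` for `k ≠ 2 dim X` (`∫_X` is
integration of top-degree forms / evaluation on `[X(ℂ)] ∈ H_{2n}`). [cite: VoisinHodgeI2002, §11.1.2] -/
theorem traceDeg_of_ne (hX : Motives.IsSmoothProjective n X) {k : ℕ} (hk : k ≠ 2 * n) :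
    traceDeg hX k = 0 :=
  dif_neg hk

end HodgeTheory

end Literature.AlgebraicGeometry.HodgeTheory

end
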